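import Summits.Langlands.Langlands.Theorems.CoreAdequacySplitKernel
import Summits.Langlands.Langlands.Theorems.LieDefectSplit
import Summits.Langlands.Langlands.Theorems.ExtendedAdequacySplit
import Literature.NumberTheory.GaloisRepresentations.ExtendedAdequateSubgroup
import Literature.NumberTheory.GaloisRepresentations.AdequateOfCoprimeOrder
import Literature.NumberTheory.GaloisRepresentations.CalegariEvenFontaineMazurTwo
import Literature.NumberTheory.GaloisRepresentations.ResidualGaloisRepOpenKernel
import Literature.RingTheory.Valuation.AlgClosedResidue

/-!
# RSL `CoreAdequacySplit.NoAdequateLayerLifting` (stmt-Langlands-27954), line `birth`, stub 3/3 `stub_coprimeTableLifting` — STRUCTURAL HELPERS, part 2: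
# the 2017 → 2012 ADEQUACY BRIDGE on the coprime rows `ℓ ∤ n`, and what it says about the TABLE

The dials of route CoreAdequacySplit are typed with Thorne's 2012 notion `Subgroup.IsThorneAdequate` (clauses on `ad⁰`), while the tree's
adequacy LIBRARY (coprime order / coprime index / degree `p` / degree two / the SXADQ dial of route ExtendedAdequacySplit) is typed with the
EXTENDED notion `Subgroup.IsExtendedAdequate` of Guralnick–Herzig–Tiep 2017 §1 = Thorne, Math. Z. 2017, Def. 2.20 (`Subgroup.IsThorne2017Adequate`;
clauses on `ad` and `ad/Z`).  On the slab `ℓ ∣ n` the two differ (the 2012 notion is empty there); on the COPRIME rows — exactly the rows of the TABLE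
stub — they agree.  This file PROVES the direction the TABLE needs (GHT 2017 §1, remark after the definition: «if `p ∤ dim V`, `k` is a direct summand
of `V* ⊗ V` …»), with no new definition:

* §1 `isThorneAdequate_of_isThorne2017Adequate` — for `(n : k) ≠ 0`, Thorne's printed Def. 2.20 implies Def. 2.3 of 2012: (ii) `(ad⁰)^H = 0` because
  `H⁰(H, ad) = Z` (landed `IsExtendedAdequate.invariants_adRep_eq`) and `Z ∩ ad⁰ = 0`; (iii) `H¹(H, ad⁰) = 0` because `ad⁰ → ad → ad/Z` is an
  `H`-isomorphism (a cocycle into `ad⁰` becomes a coboundary `h ↦ h·M₀ − M₀` modulo `Z`, and the trace-zero part `M₀ − (tr M₀/n)·1` bounds it in `ad⁰`: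
  the defect is scalar of trace zero); (iv) a simple `k[H]`-submodule of `ad⁰` is a simple submodule of `ad` (atom transport along `ad⁰ ↪ ad`).
  Over an algebraically closed `k` (e.g. `𝔽̄_ℓ = padicAlgClResidueField ℓ`) hence `IsExtendedAdequate → IsThorneAdequate`
  (`isThorneAdequate_of_isExtendedAdequate`, through the landed `Subgroup.isThorne2017Adequate_iff_isExtendedAdequate`).
* §2 Consequences for the TABLE (`ℓ ∤ n`): an extended-adequate layer above the perfect core is a 2012-adequate layer
  (`solvAdequateBetween_of_extAdequateBetween`), so SXADQ ⟹ SADQ (`solvablyAdequateImage_of_solvablyExtAdequateImage`) and the TABLE's hypothesis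
  ¬SADQ puts every instance in the ¬SXADQ region of route ExtendedAdequacySplit (`not_solvablyExtAdequateImage_of_coprime_row`); and by the landed
  coprime-order lemma (`Subgroup.isExtendedAdequate_of_not_dvd_card`, Maschke + Burnside) together with finiteness of residual images
  (`isOpen_ker_of_isReductionOf`, `Γ` compact), on the TABLE every absolutely irreducible layer `J` of the image `I = τ(Γ_{K(ζ_ℓ)})` above the perfect
  core — in particular `I` itself — has ORDER DIVISIBLE BY `ℓ` (`dvd_card_layer_of_coprime_row`, `dvd_card_image_of_coprime_row`): the residual
  table has no `ℓ′`-rows.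

Vocabulary BY NAME: `Theorems.CoreAdequacy.{IsPerfectCore, perfectCore, SolvAdequateBetween, CycIrr, AdequateCyclotomicImage, SolvablyAdequateImage}`,
`…LieDefect.AboveCore`, `…ExtAdequacy.{ExtAdequateBetween, SolvablyExtAdequateImage}`, Literature `Subgroup.IsThorneAdequate / IsThorne2017Adequate /
IsExtendedAdequate`, `charP_padicAlgClResidueField`, `Literature.RingTheory.Valuation.isAlgClosed_residueField` (𝔽̄_ℓ algebraically closed; also landed as `DyadicDihedralFM.isAlgClosed_padicAlgClResidueField`).  0 sorry.
-/

set_option linter.dupNamespace false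

namespace Summit.Langlands.Langlands.Theorems.CoreAdequacy.CoprimeTable

open Filter
open scoped MatrixGroups
open Literature.NumberTheory.GaloisRepresentations
open Summit.Langlands.Langlands.Theses

universe u

/-! ## §1 The bridge: Thorne 2017 (Def. 2.20) / GHT-extended adequacy ⟹ Thorne 2012 (Def. 2.3) adequacy when `n ≠ 0` in `k` -/

section Bridge

variable {k : Type u} [Field k] {n : ℕ}

/-- A scalar matrix of trace zero vanishes when `n ≠ 0` in `k` (`Z ∩ ad⁰ = 0`). -/
theorem eq_zero_of_mem_scalarMatrices_of_trace_eq_zero (hn : (n : k) ≠ 0) {M : Matrix (Fin n) (Fin n) k}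
    (hM : M ∈ scalarMatrices (Fin n) k) (htr : M.trace = 0) : M = 0 := by
  obtain ⟨c, rfl⟩ := (mem_scalarMatrices_iff M).1 hM
  rw [Matrix.trace_smul, Matrix.trace_one, Fintype.card_fin, smul_eq_mul] at htr
  rcases mul_eq_zero.1 htr with hc | hn'
  · rw [hc, zero_smul]
  · exact absurd hn' hn

/-- The trace-zero part `M − (tr M / n) · 1` of a matrix has trace zero (`n ≠ 0` in `k`): `ad = ad⁰ ⊕ Z`. -/
theorem trace_sub_smul_one_eq_zero (hn : (n : k) ≠ 0) (M : Matrix (Fin n) (Fin n) k) :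
    (M - (M.trace / n) • (1 : Matrix (Fin n) (Fin n) k)).trace = 0 := by
  rw [Matrix.trace_sub, Matrix.trace_smul, Matrix.trace_one, Fintype.card_fin, smul_eq_mul,
    div_mul_cancel₀ _ hn, sub_self]

/-- **Clause (ii) of 2012 from the span clause of 2017**: if the semisimple elements of `H` span `M_n(k)` (so `H⁰(H, ad) = Z`, landed
`IsExtendedAdequate.invariants_adRep_eq`) and `n ≠ 0` in `k`, then `(ad⁰)^H = 0`. -/
theorem adZeroRep_invariants_eq_bot_of_isExtendedAdequate (hn : (n : k) ≠ 0) {H : Subgroup (GL (Fin n) k)}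
    (hH : Subgroup.IsExtendedAdequate H) : (Subgroup.adZeroRep H).invariants = ⊥ := by
  refine (Submodule.eq_bot_iff _).2 fun M hM => ?_
  have hfix := (Representation.mem_invariants _ M).1 hM
  have hM1 : (M : Matrix (Fin n) (Fin n) k) ∈ (Subgroup.adRep H).invariants := by
    refine (Representation.mem_invariants _ _).2 fun h => ?_
    have e := congrArg Subtype.val (hfix h)
    rw [Subgroup.coe_adZeroRep_apply] at e
    rw [Subgroup.adRep_apply]
    exact e
  rw [hH.invariants_adRep_eq] at hM1
  exact Subtype.ext (eq_zero_of_mem_scalarMatrices_of_trace_eq_zero hn hM1 ((mem_adZero_toSubmodule_iff _).1 M.2))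

/-- **Clause (iii) of 2012 from clause (i, second half) of 2017**: if `H¹(H, ad/Z) = 0` and `n ≠ 0` in `k` then `H¹(H, ad⁰) = 0` — a
`1`-cocycle `f : H → ad⁰` is, modulo `Z`, the coboundary of some `M₀ ∈ ad`; replacing `M₀` by its trace-zero part `M` changes nothing modulo `Z`,
and `f(h) − (h M h⁻¹ − M)` is then scalar AND of trace zero, hence `0`. -/
theorem adZeroRep_cocycles₁_le_coboundaries₁_of_isExtendedAdequate (hn : (n : k) ≠ 0) {H : Subgroup (GL (Fin n) k)}
    (hH : Subgroup.IsExtendedAdequate H) :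
    groupCohomology.cocycles₁ (Rep.of (Subgroup.adZeroRep H)) ≤ groupCohomology.coboundaries₁ (Rep.of (Subgroup.adZeroRep H)) := by
  refine (cocycles₁_le_coboundaries₁_iff_forall _).2 fun f hf => ?_
  -- push the cocycle to `ad/Z`
  have hf' : ∀ g h : H, (scalarMatrices (Fin n) k).mkQ ((f (g * h) : (adZero (Fin n) k).toSubmodule) : Matrix (Fin n) (Fin n) k) =
      Subgroup.adModScalarRep H g ((scalarMatrices (Fin n) k).mkQ ((f h : (adZero (Fin n) k).toSubmodule) : Matrix (Fin n) (Fin n) k)) +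
        (scalarMatrices (Fin n) k).mkQ ((f g : (adZero (Fin n) k).toSubmodule) : Matrix (Fin n) (Fin n) k) := by
    intro g h
    have e := congrArg Subtype.val (hf g h)
    rw [Subgroup.adModScalarRep_apply_mkQ, ← map_add]
    exact congrArg _ e
  obtain ⟨m, hm⟩ := hH.exists_eq_sub_of_cocycle
    (fun g => (scalarMatrices (Fin n) k).mkQ ((f g : (adZero (Fin n) k).toSubmodule) : Matrix (Fin n) (Fin n) k)) hf'
  obtain ⟨M₀, rfl⟩ := Submodule.mkQ_surjective _ m
  -- the trace-zero part of `M₀`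
  set M : Matrix (Fin n) (Fin n) k := M₀ - (M₀.trace / n) • (1 : Matrix (Fin n) (Fin n) k) with hMdef
  have hMtr : M.trace = 0 := trace_sub_smul_one_eq_zero hn M₀
  refine ⟨⟨M, (mem_adZero_toSubmodule_iff M).2 hMtr⟩, fun g => Subtype.ext ?_⟩
  have hg := hm g
  rw [Subgroup.adModScalarRep_apply_mkQ, ← map_sub] at hg
  have hdiff : ((f g : (adZero (Fin n) k).toSubmodule) : Matrix (Fin n) (Fin n) k) - (Subgroup.adRep H g M₀ - M₀) ∈
      scalarMatrices (Fin n) k :=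
    (Submodule.Quotient.eq _).1 hg
  have h1 : Subgroup.adRep H g (1 : Matrix (Fin n) (Fin n) k) = 1 := by
    rw [Subgroup.adRep_apply, Matrix.mul_one, Units.mul_inv]
  have hMM : Subgroup.adRep H g M - M = Subgroup.adRep H g M₀ - M₀ := by
    rw [hMdef, map_sub, map_smul, h1]
    abel
  have htrD : (((f g : (adZero (Fin n) k).toSubmodule) : Matrix (Fin n) (Fin n) k) - (Subgroup.adRep H g M - M)).trace = 0 := by
    rw [Matrix.trace_sub, (mem_adZero_toSubmodule_iff _).1 (f g).2, Matrix.trace_sub, Subgroup.adRep_apply,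
      Matrix.trace_mul_cycle, Units.inv_mul, Matrix.one_mul, hMtr, sub_self, sub_zero]
  have hD : ((f g : (adZero (Fin n) k).toSubmodule) : Matrix (Fin n) (Fin n) k) - (Subgroup.adRep H g M - M) = 0 :=
    eq_zero_of_mem_scalarMatrices_of_trace_eq_zero hn (by rw [hMM]; exact hdiff) htrD
  have hfg : ((f g : (adZero (Fin n) k).toSubmodule) : Matrix (Fin n) (Fin n) k) = Subgroup.adRep H g M - M := sub_eq_zero.1 hD
  rw [hfg, Rep.of_ρ, Submodule.coe_sub, Subgroup.coe_adZeroRep_apply, Subgroup.adRep_apply]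

/-- **Clause (iv) of 2012 from clause (ii) of Thorne's Def. 2.20**: a simple `k[H]`-submodule `W ⊆ ad⁰` is a simple `k[H]`-submodule of `ad`
(its image under `ad⁰ ↪ ad` is an atom: sub-objects pull back), so the printed eigenprojection clause on `ad` restricts to `ad⁰`. -/
theorem adZeroRep_exists_trace_eigenprojection_ne_zero_of_isThorne2017Adequate {H : Subgroup (GL (Fin n) k)}
    (hH : Subgroup.IsThorne2017Adequate H) (W : Subrepresentation (Subgroup.adZeroRep H)) (hW : IsAtom W) :
    ∃ h : H, (orderOf (h : GL (Fin n) k)).Coprime (ringChar k) ∧ ∃ α : k, ∃ w ∈ W,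
      (eigenprojectionMatrix (((h : GL (Fin n) k)) : Matrix (Fin n) (Fin n) k) α * (w : Matrix (Fin n) (Fin n) k)).trace ≠ 0 := by
  classical
  -- the image `W'` of `W` in `ad`
  let W' : Subrepresentation (Subgroup.adRep H) :=
    { toSubmodule := W.toSubmodule.map (adZero (Fin n) k).toSubmodule.subtype
      apply_mem_toSubmodule := by
        intro g v hv
        obtain ⟨w, hw, rfl⟩ := Submodule.mem_map.1 hv
        exact Submodule.mem_map.2 ⟨Subgroup.adZeroRep H g w, W.apply_mem_toSubmodule g hw, rfl⟩ }
  have hmemW' : ∀ v : Matrix (Fin n) (Fin n) k, v ∈ W' ↔ v ∈ W.toSubmodule.map (adZero (Fin n) k).toSubmodule.subtype := fun v => Iff.rfl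
  have hW' : IsAtom W' := by
    refine ⟨fun hbot => hW.1 ?_, fun V hV => ?_⟩
    · -- `W' = ⊥ ⇒ W = ⊥`
      apply Subrepresentation.toSubmodule_injective
      refine (Submodule.eq_bot_iff _).2 fun w hw => ?_
      have hw' : (w : Matrix (Fin n) (Fin n) k) ∈ W' := (hmemW' _).2 (Submodule.mem_map.2 ⟨w, hw, rfl⟩)
      rw [hbot] at hw'
      exact Subtype.ext ((Submodule.mem_bot k).1 hw')
    · -- `V < W' ⇒ V = ⊥`: pull `V` back to `ad⁰`
      let V₀ : Subrepresentation (Subgroup.adZeroRep H) :=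
        { toSubmodule := V.toSubmodule.comap (adZero (Fin n) k).toSubmodule.subtype
          apply_mem_toSubmodule := fun g w hw => V.apply_mem_toSubmodule g hw }
      have hmemV₀ : ∀ w : (adZero (Fin n) k).toSubmodule, w ∈ V₀ ↔ (w : Matrix (Fin n) (Fin n) k) ∈ V := fun w => Iff.rfl
      have hV₀le : V₀ ≤ W := by
        intro w hw
        have hw' : (w : Matrix (Fin n) (Fin n) k) ∈ W' := hV.le ((hmemV₀ w).1 hw)
        obtain ⟨w₁, hw₁, he⟩ := Submodule.mem_map.1 ((hmemW' _).1 hw')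
        have : w₁ = w := Subtype.ext he
        rw [← this]
        exact hw₁
      have hV₀ne : V₀ ≠ W := by
        intro hVW
        refine hV.ne (le_antisymm hV.le fun v hv => ?_)
        obtain ⟨w, hw, rfl⟩ := Submodule.mem_map.1 ((hmemW' _).1 hv)
        have hw0 : w ∈ V₀ := hVW ▸ hw
        exact (hmemV₀ w).1 hw0
      have hV₀bot : V₀ = ⊥ := hW.2 V₀ (lt_of_le_of_ne hV₀le hV₀ne)
      apply Subrepresentation.toSubmodule_injective
      refine (Submodule.eq_bot_iff _).2 fun v hv => ?_
      obtain ⟨w, -, rfl⟩ := Submodule.mem_map.1 ((hmemW' _).1 (hV.le hv))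
      have hw0 : w ∈ V₀ := (hmemV₀ w).2 hv
      rw [hV₀bot] at hw0
      have hw00 : w = 0 := (Submodule.mem_bot k).1 hw0
      rw [hw00]
      rfl
  obtain ⟨h, hh, α, w', hw', htr⟩ := hH.exists_trace_eigenprojection_ne_zero W' hW'
  obtain ⟨w, hw, rfl⟩ := Submodule.mem_map.1 ((hmemW' _).1 hw')
  exact ⟨h, hh, α, w, hw, htr⟩

/-- **BRIDGE (Thorne, Math. Z. 2017, Def. 2.20 ⟹ Thorne 2012, Def. 2.3, for `n ≠ 0` in `k`).**  Over any field: (i) is common, (ii)–(iii) by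
`ad = ad⁰ ⊕ Z`, (iv) by atom transport.  (GHT 2017 §1: the extended notion «includes the case `p ∣ dim V`»; off that case nothing is lost.) -/
theorem isThorneAdequate_of_isThorne2017Adequate (hn : (n : k) ≠ 0) {H : Subgroup (GL (Fin n) k)}
    (hH : Subgroup.IsThorne2017Adequate H) : Subgroup.IsThorneAdequate H :=
  ⟨hH.addMonoidHom_eq_zero, adZeroRep_invariants_eq_bot_of_isExtendedAdequate hn hH.isExtendedAdequate,
    adZeroRep_cocycles₁_le_coboundaries₁_of_isExtendedAdequate hn hH.isExtendedAdequate,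
    adZeroRep_exists_trace_eigenprojection_ne_zero_of_isThorne2017Adequate hH⟩

/-- **BRIDGE over an algebraically closed field** (e.g. `𝔽̄_ℓ`): GHT-extended adequacy ⟹ Thorne-2012 adequacy when `n ≠ 0` in `k`
(landed `Subgroup.isThorne2017Adequate_iff_isExtendedAdequate` + the previous theorem). -/
theorem isThorneAdequate_of_isExtendedAdequate [IsAlgClosed k] (hn : (n : k) ≠ 0) {H : Subgroup (GL (Fin n) k)}
    (hH : Subgroup.IsExtendedAdequate H) : Subgroup.IsThorneAdequate H :=
  isThorneAdequate_of_isThorne2017Adequate hn ((Subgroup.isThorne2017Adequate_iff_isExtendedAdequate H).2 hH)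

/-- **An extended-adequate layer above the perfect core is a 2012-adequate layer** (`k` algebraically closed, `n ≠ 0` in `k`):
`ExtAdequateBetween I → SolvAdequateBetween I`. -/
theorem solvAdequateBetween_of_extAdequateBetween [IsAlgClosed k] (hn : (n : k) ≠ 0) {I : Subgroup (GL (Fin n) k)}
    (h : ExtAdequacy.ExtAdequateBetween I) : SolvAdequateBetween I := by
  obtain ⟨J, hPJ, hJI, hirr, hX⟩ := h
  obtain ⟨P, hP, hPJ'⟩ := LieDefect.aboveCore_iff_exists_isPerfectCore.1 hPJ
  exact ⟨P, J, hP, hPJ', hJI, hirr, isThorneAdequate_of_isExtendedAdequate hn hX⟩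

/-- **Coprime-order layers are adequate layers** (`k` algebraically closed of characteristic `p`, `n ≠ 0` in `k`): a finite absolutely
irreducible `J` with `perfectCore I ≤ J ≤ I` and `p ∤ |J|` witnesses `SolvAdequateBetween I` (landed `Subgroup.isExtendedAdequate_of_not_dvd_card`). -/
theorem solvAdequateBetween_of_layer_not_dvd_card [IsAlgClosed k] {p : ℕ} [Fact p.Prime] [CharP k p] (hn : (n : k) ≠ 0)
    {I J : Subgroup (GL (Fin n) k)} [Finite J] (hPJ : perfectCore I ≤ J) (hJI : J ≤ I) (hcard : ¬ p ∣ Nat.card J)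
    (hirr : IsAbsIrreducible J.subtype) : SolvAdequateBetween I :=
  ⟨perfectCore I, J, isPerfectCore_perfectCore I, hPJ, hJI, hirr,
    isThorneAdequate_of_isExtendedAdequate hn (Subgroup.isExtendedAdequate_of_not_dvd_card J hcard hirr)⟩

end Bridge

/-! ## §2 Consequences for the coprime rows of the residual table (`k = 𝔽̄_ℓ = padicAlgClResidueField ℓ`, `ℓ ∤ n`) -/

section Coprime

variable {K : Type} [Field K] [NumberField K] {ℓ : ℕ} [Fact ℓ.Prime] {n : ℕ}

/-- On a coprime row, `n ≠ 0` in `𝔽̄_ℓ` (landed `charP_padicAlgClResidueField`). -/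
theorem natCast_ne_zero_of_not_dvd (hℓn : ¬ ℓ ∣ n) : (n : padicAlgClResidueField ℓ) ≠ 0 := by
  haveI := charP_padicAlgClResidueField ℓ
  exact fun h => hℓn ((CharP.cast_eq_zero_iff (padicAlgClResidueField ℓ) ℓ n).1 h)

/-- **On the coprime rows SXADQ ⟹ SADQ**: an extended-adequate solvable layer of the image over `K(ζ_ℓ)` is a Thorne-2012-adequate one. -/
theorem solvablyAdequateImage_of_solvablyExtAdequateImage (hℓn : ¬ ℓ ∣ n) {ρ : FramedGaloisRep K (PadicAlgCl ℓ) n}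
    (h : ExtAdequacy.SolvablyExtAdequateImage ρ) : SolvablyAdequateImage ρ := by
  haveI : IsAlgClosed (padicAlgClResidueField ℓ) := Literature.RingTheory.Valuation.isAlgClosed_residueField (padicAlgClIntegers ℓ)
  obtain ⟨τ, hτ, hirr, hX⟩ := (ExtAdequacy.solvablyExtAdequateImage_iff ρ).1 h
  exact (solvablyAdequateImage_iff ρ).2 ⟨τ, hτ, hirr, solvAdequateBetween_of_extAdequateBetween (natCast_ne_zero_of_not_dvd hℓn) hX⟩

/-- **The TABLE lies in the ¬SXADQ region of route ExtendedAdequacySplit**: on a coprime row the RSL hypothesis «no adequate layer» excludes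
extended-adequate layers as well. -/
theorem not_solvablyExtAdequateImage_of_coprime_row (hℓn : ¬ ℓ ∣ n) {ρ : FramedGaloisRep K (PadicAlgCl ℓ) n}
    (hN : ¬ SolvablyAdequateImage ρ) : ¬ ExtAdequacy.SolvablyExtAdequateImage ρ :=
  fun h => hN (solvablyAdequateImage_of_solvablyExtAdequateImage hℓn h)

/-- A reduction of a continuous `ρ : Γ_K → GL_n(ℚ̄_ℓ)` has FINITE image: its kernel is open (landed `isOpen_ker_of_isReductionOf`,
Deligne–Serre 6.12) in the compact group `Γ_K`. -/
theorem finite_range_of_isReductionOf {k : Type u} [Field k] {ι : padicAlgClResidueField ℓ →+* k} {ρ : FramedGaloisRep K (PadicAlgCl ℓ) n}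
    {τ : Field.absoluteGaloisGroup K →* GL (Fin n) k} (hτ : ρ.IsReductionOf ι τ) : Finite τ.range := by
  have hopen : IsOpen (τ.ker : Set (Field.absoluteGaloisGroup K)) := FramedGaloisRep.isOpen_ker_of_isReductionOf hτ
  haveI : Finite (Field.absoluteGaloisGroup K ⧸ τ.ker) := Subgroup.quotient_finite_of_isOpen _ hopen
  exact Finite.of_equiv _ (QuotientGroup.quotientKerEquivRange τ).toEquiv

/-- **On the TABLE every absolutely irreducible layer of the image has order divisible by `ℓ`.**  For a coprime row `ℓ ∤ n`, an instance with
«no adequate layer» (¬SADQ), any absolutely irreducible reduction `τ` of `ρ|Γ_{K(ζ_ℓ)}` and any absolutely irreducible `J` with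
`perfectCore I ≤ J ≤ I = τ(Γ_{K(ζ_ℓ)})`: `ℓ ∣ |J|` (else `J` is an `ℓ′`-group acting absolutely irreducibly, hence extended-adequate by Maschke +
Burnside, hence — coprime row, `𝔽̄_ℓ` algebraically closed — a 2012-adequate layer). -/
theorem dvd_card_layer_of_coprime_row (hℓn : ¬ ℓ ∣ n) {ρ : FramedGaloisRep K (PadicAlgCl ℓ) n} (hN : ¬ SolvablyAdequateImage ρ)
    {τ : Field.absoluteGaloisGroup (CyclotomicField ℓ K) →* GL (Fin n) (padicAlgClResidueField ℓ)}
    (hτ : (ρ.restrictField (CyclotomicField ℓ K)).IsReductionOf (RingHom.id _) τ) (hirr : IsAbsIrreducible τ)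
    {J : Subgroup (GL (Fin n) (padicAlgClResidueField ℓ))} (hPJ : perfectCore τ.range ≤ J) (hJI : J ≤ τ.range)
    (hJirr : IsAbsIrreducible J.subtype) : ℓ ∣ Nat.card J := by
  haveI : IsAlgClosed (padicAlgClResidueField ℓ) := Literature.RingTheory.Valuation.isAlgClosed_residueField (padicAlgClIntegers ℓ)
  haveI := charP_padicAlgClResidueField ℓ
  haveI : Finite τ.range := finite_range_of_isReductionOf hτ
  haveI : Finite J := Finite.of_injective _ (Subgroup.inclusion_injective hJI)
  by_contra hcard
  exact hN ((solvablyAdequateImage_iff ρ).2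
    ⟨τ, hτ, hirr, solvAdequateBetween_of_layer_not_dvd_card (natCast_ne_zero_of_not_dvd hℓn) hPJ hJI hcard hJirr⟩)

/-- **In particular the residual image itself has order divisible by `ℓ` on the TABLE**: for `ℓ ∤ n` and ¬SADQ, every absolutely irreducible
reduction `τ` of `ρ|Γ_{K(ζ_ℓ)}` has `ℓ ∣ |τ(Γ_{K(ζ_ℓ)})|` — the coprime rows of the residual table carry no `ℓ′`-images (e.g. at `(2, 5)` the image
is not of order prime to `5`, consistent with the census: projectively `PSL₂(𝔽₅)`). -/
theorem dvd_card_image_of_coprime_row (hℓn : ¬ ℓ ∣ n) {ρ : FramedGaloisRep K (PadicAlgCl ℓ) n} (hN : ¬ SolvablyAdequateImage ρ)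
    {τ : Field.absoluteGaloisGroup (CyclotomicField ℓ K) →* GL (Fin n) (padicAlgClResidueField ℓ)}
    (hτ : (ρ.restrictField (CyclotomicField ℓ K)).IsReductionOf (RingHom.id _) τ) (hirr : IsAbsIrreducible τ) :
    ℓ ∣ Nat.card τ.range :=
  dvd_card_layer_of_coprime_row hℓn hN hτ hirr (isPerfectCore_perfectCore τ.range).1 le_rfl hirr.range_subtype

/-- **CycIrr-form**: on a coprime row with ¬SADQ, the witness `τ` of `CycIrr ρ` has image of order divisible by `ℓ` and no extended-adequate
layer; packaged for the TABLE stub's hypotheses (`CycIrr ρ`, `¬ SolvablyAdequateImage ρ`). -/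
theorem exists_image_dvd_card_of_coprime_row (hℓn : ¬ ℓ ∣ n) {ρ : FramedGaloisRep K (PadicAlgCl ℓ) n} (hc : CycIrr ρ)
    (hN : ¬ SolvablyAdequateImage ρ) :
    ∃ τ : Field.absoluteGaloisGroup (CyclotomicField ℓ K) →* GL (Fin n) (padicAlgClResidueField ℓ),
      (ρ.restrictField (CyclotomicField ℓ K)).IsReductionOf (RingHom.id _) τ ∧ IsAbsIrreducible τ ∧ Finite τ.range ∧
        ℓ ∣ Nat.card τ.range ∧ ¬ ExtAdequacy.ExtAdequateBetween τ.range := by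
  obtain ⟨τ, hτ, hirr⟩ := hc
  haveI : IsAlgClosed (padicAlgClResidueField ℓ) := Literature.RingTheory.Valuation.isAlgClosed_residueField (padicAlgClIntegers ℓ)
  refine ⟨τ, hτ, hirr, finite_range_of_isReductionOf hτ, dvd_card_image_of_coprime_row hℓn hN hτ hirr, fun hX => hN ?_⟩
  exact (solvablyAdequateImage_iff ρ).2 ⟨τ, hτ, hirr, solvAdequateBetween_of_extAdequateBetween (natCast_ne_zero_of_not_dvd hℓn) hX⟩

end Coprime

end Summit.Langlands.Langlands.Theorems.CoreAdequacy.CoprimeTable
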